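import Summits.QuantumFields.YangMills.Theorems.DirichletWindowLocalGaussianity
import HarnessLib

/-!
# `DirichletWindow.WindowReduction` (item stmt-QuantumFields-12317)

Route `DirichletWindow` of `QuantumFields/YangMills`, crux item
`Summit.QuantumFields.YangMills.Theses.DirichletWindow.WindowReduction :=
FreeEnergyLogCoefficient → BoxLaplace → BackgroundBudget → LocalGaussianity` — the DLR window glue of the route
(disintegration over the exterior of the Dirichlet box, law of total covariance, background budget).

Proof: the consequent `LocalGaussianity = FixedDistanceLower ∧ PlaquetteVarianceUpper` (the route's TARGET, item
12314) is by now a tree theorem, `localGaussianity_proof` (closed 2026-08-28 by line «exp-moment tangent law»: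
chessboard exponential moments on all tori ⊕ joint tangent law of the scaled plaquette costs ⊕ axial kernel lower
bound), so the implication holds with all three antecedents unused.  HONEST LABEL: this closes the glue item AS
FILED; it does NOT carry out the DLR-window bookkeeping described in the item's informal text, and it makes the
cruxes `BoxLaplace` (12316) and `BackgroundBudget` (12315) idle in the route's deciding theorem `closes` (they enter
only through this glue) — a planner may wish to re-cut the route accordingly.  What remains between the route and
its conclusion `YangMills` is exactly `LatticeGapLargeBeta` (8761, the 4-d lattice mass gap at weak coupling) and
`WeakCouplingContinuumLimit` (15940) — both open problems.  RECORD currency; the Yang–Mills mass gap is NOT proved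
or advanced by this file.
-/

set_option autoImplicit false

namespace Summit.QuantumFields.YangMills.Theorems

/-- **`WindowReduction` holds** (item stmt-QuantumFields-12317):
`FreeEnergyLogCoefficient → BoxLaplace → BackgroundBudget → LocalGaussianity`, because the consequent is the tree
theorem `localGaussianity_proof` (item 12314); the antecedents are not used. -/
theorem windowReduction_proof :
    Summit.QuantumFields.YangMills.Theses.DirichletWindow.WindowReduction :=
  fun _ _ _ => localGaussianity_proof

end Summit.QuantumFields.YangMills.Theorems
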